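import Summits.QuantumFields.YangMills.Theorems.BalabanLadderUVSeamRecClassicalResponseSemiclassical
import HarnessLib

/-!
# Crux `UVSeamRec` (stmt-QuantumFields-20043): the fixed-scale classical split, uniformly in the site and over bounded scale ranges —
# translation covariance of the classical carrier, and the ONSET reformulation of (split-cl)

Helper file (`--supports stmt-QuantumFields-20043`) of the LEAD seat `ym-spine-20043-p1` (gen 10); part 2 of 2, sequel of
`…ClassicalResponseSemiclassical` (§1–§3: at every FIXED cube radius `R`, orientation `q` and site `x` the flag-free classical split
`(R⁴/C₁)|kerE^η_β(plane q x) − N| ≤ A₀ + carrierCl r C_s 1 β R q x η` holds for all `β ≥ β₁` and ALL exteriors, by Laplace's principle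
uniformly on the closed low-response set of exteriors).

WHAT IS PROVED (every compact `G`, every lattice representation `r`, unless marked `SU(2)`):
* §4 TRANSLATION COVARIANCE of the LEAD's classical objects (p546887): `configShift_glueWith` (gluing commutes with translations),
  `tiltedAction_configShift`, `tiltedMin_configShift`, **`classicalResponse_configShift`**, **`carrierCl_configShift`** — the classical
  response and the carrier are invariant when cube, plaquette and exterior move together (tree `wilsonBoundaryAction_configShift`,
  `plane_configShift`, `cubeEdges_map_edgeShift`); hence `pureSplit_fixedScale_uniform`: the onset `β₁` of part 1's §3 does not depend
  on the site (`kerE_plane_configShift` on the quantum side).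
* §5 `pureSplit_boundedScales` — ONE onset for all `1 ≤ R ≤ R_max`, all orientations, sites and exteriors (finite maxima);
  `splitCl_inequality_boundedScales` (`SU(2)`) — literally the integrand inequality of `ClassicalResponse.SplitCl` with ANY tempering data
  (`influenceAt ≥ 0` added for free) and reference value `p q β := 2`, at the scales `R ≤ R_max`;
  **`pureSplitCl_of_onset`** (`SU(2)`) — the located REFORMULATION: tempered-d1's `PureSplitCl C_s C₁ A₀ β₀ ℓ₁ p` FOLLOWS from the
  fixed-scale split with onset function `β₁ : ℕ → ℝ` as soon as the onset is dominated by the record's scale window,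
  `∀ β ≥ β₀, ∀ R ≥ 1, R·uRec β ≤ ℓ₁ → β₁ R ≤ β` — i.e. `β₁(R) ≲ uRec⁻¹(ℓ₁/R) ≈ 4b₀·log(R c₀/ℓ₁)`.

HONEST READING.  Part 1 supplies the fixed-scale hypothesis of `pureSplitCl_of_onset` with an INEFFECTIVE onset (compactness) and
`p ≡ N`; the renormalisation-group content of (split-cl) is an effective logarithmic onset (asymptotic freedom of the background-field
expansion).  Bookkeeping and folklore (translation invariance of the Wilson action, Georgii 2011 §5.1); nothing here asserts (split-cl),
(GD), (UCR) or anything of E0′; not a gap claim, not Clay.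
-/

set_option autoImplicit false

noncomputable section

open MeasureTheory Filter Topology Set
open Literature.MathematicalPhysics.QuantumFieldTheory (LatticeRep)
open Literature.MathematicalPhysics.QuantumLattice (LGConfig wilsonBoundaryAction fundamentalLatticeRep fundamentalLatticeRep_N)
open Literature.Probability.LatticeModels
open Summit.QuantumFields.YangMills.Cruxes.OSLegsFromFemtoAndGap.DlrCollarTransfer

namespace Summit.QuantumFields.YangMills.Cruxes.UVSeamRec.ClassicalResponse

variable {G : Type} [Group G] [TopologicalSpace G] [IsTopologicalGroup G] [CompactSpace G]
  [MeasurableSpace G] [BorelSpace G] (r : LatticeRep G)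

/-! ## §4 Translation covariance of the classical response and of the carrier; uniformity in the site -/

section Translation

open Summit.QuantumFields.YangMills.Cruxes.NT.BoundaryLaw (cubeEdges_map_edgeShift configShift_configShift plane_configShift
  kerE_plane_configShift)
open Literature.MathematicalPhysics.QuantumLattice (ZdEdge configShift edgeShift_symm_apply wilsonBoundaryAction_configShift)

omit [TopologicalSpace G] [IsTopologicalGroup G] [CompactSpace G] [BorelSpace G] in
/-- Membership in the translated cube's interior edges. [folklore] -/
theorem mem_cubeEdges_add_iff (c v : Fin 4 → ℤ) (b : ℕ) (e : ZdEdge 4) :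
    e ∈ cubeEdges (c + v) b ↔ ((e.1 - v, e.2) : ZdEdge 4) ∈ cubeEdges c b := by
  rw [← cubeEdges_map_edgeShift c v b, Finset.mem_map_equiv, edgeShift_symm_apply]

omit [Group G] [TopologicalSpace G] [IsTopologicalGroup G] [CompactSpace G] [BorelSpace G] in
/-- **Gluing commutes with translations**: translating `ζ ⊔_{cube} η` by `v` is the transported interior data glued, inside the
translated cube, into the translated exterior (cf. tree `relabelConfig_comp_glueWith`). [folklore] -/
theorem configShift_glueWith (c v : Fin 4 → ℤ) (b : ℕ) (ζ : ↥(cubeEdges c b) → G) (η : LGConfig 4 G) :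
    configShift v (glueWith (cubeEdges c b) ζ η) =
      glueWith (cubeEdges (c + v) b) (fun e' : ↥(cubeEdges (c + v) b) =>
        ζ ⟨(((e' : ZdEdge 4).1 - v, (e' : ZdEdge 4).2) : ZdEdge 4), (mem_cubeEdges_add_iff c v b e').1 e'.2⟩)
        (configShift v η) := by
  funext e'
  rw [Literature.MathematicalPhysics.QuantumLattice.configShift_apply]
  by_cases h : e' ∈ cubeEdges (c + v) b
  · rw [glueWith_apply_mem _ _ _ h, glueWith_apply_mem _ _ _ ((mem_cubeEdges_add_iff c v b e').1 h)]
  · have h' : (((e'.1 - v, e'.2)) : ZdEdge 4) ∉ cubeEdges c b := fun h' => h ((mem_cubeEdges_add_iff c v b e').2 h')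
    rw [glueWith_apply_not_mem _ _ _ h, glueWith_apply_not_mem _ _ _ h',
      Literature.MathematicalPhysics.QuantumLattice.configShift_apply]

omit [IsTopologicalGroup G] [CompactSpace G] [BorelSpace G] in
/-- The tilted cube functional is translation invariant (cube, plaquette, exterior and interior data moved together):
boundary Wilson action by `wilsonBoundaryAction_configShift`, centre plaquette by `plane_configShift`. [folklore] -/
theorem tiltedAction_configShift (c v : Fin 4 → ℤ) (b : ℕ) (q : Fin 4 × Fin 4) (x : Fin 4 → ℤ) (s : ℝ) (η : LGConfig 4 G)
    (ζ : ↥(cubeEdges c b) → G) :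
    tiltedAction r (c + v) b q (x + v) s (configShift v η)
        (fun e' : ↥(cubeEdges (c + v) b) =>
          ζ ⟨(((e' : ZdEdge 4).1 - v, (e' : ZdEdge 4).2) : ZdEdge 4), (mem_cubeEdges_add_iff c v b e').1 e'.2⟩) =
      tiltedAction r c b q x s η ζ := by
  unfold tiltedAction
  have hW : ∀ U : LGConfig 4 G,
      wilsonBoundaryAction r.ρ (cubeEdges (c + v) b) (configShift v U) = wilsonBoundaryAction r.ρ (cubeEdges c b) U := fun U => by
    rw [← cubeEdges_map_edgeShift c v b]
    exact wilsonBoundaryAction_configShift r.ρ v (cubeEdges c b) U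
  rw [← configShift_glueWith, hW, plane_configShift]

omit [BorelSpace G] in
/-- Translating cube, plaquette and exterior together does not increase the tilted minimum. [folklore] -/
theorem tiltedMin_configShift_le (c v : Fin 4 → ℤ) (b : ℕ) (q : Fin 4 × Fin 4) (x : Fin 4 → ℤ) (s : ℝ) (η : LGConfig 4 G) :
    tiltedMin r (c + v) b q (x + v) s (configShift v η) ≤ tiltedMin r c b q x s η := by
  obtain ⟨ζ₀, hζ₀⟩ := exists_tiltedMin_eq (r := r) c b q x s η
  rw [← hζ₀, ← tiltedAction_configShift r c v b q x s η ζ₀]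
  exact tiltedMin_le _ _ _ _ _ _ _

omit [BorelSpace G] in
/-- **Translation invariance of the tilted classical cube energy.** [folklore] -/
theorem tiltedMin_configShift (c v : Fin 4 → ℤ) (b : ℕ) (q : Fin 4 × Fin 4) (x : Fin 4 → ℤ) (s : ℝ) (η : LGConfig 4 G) :
    tiltedMin r (c + v) b q (x + v) s (configShift v η) = tiltedMin r c b q x s η := by
  refine le_antisymm (tiltedMin_configShift_le r c v b q x s η) ?_
  have h := tiltedMin_configShift_le r (c + v) (-v) b q (x + v) s (configShift v η)
  have h0 : configShift (-v) (configShift v η) = η := by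
    rw [configShift_configShift, neg_add_cancel]; funext e; simp
  rwa [h0, add_neg_cancel_right, add_neg_cancel_right] at h

omit [BorelSpace G] in
/-- **Translation invariance of the classical response.** [folklore] -/
theorem classicalResponse_configShift (c v : Fin 4 → ℤ) (b : ℕ) (q : Fin 4 × Fin 4) (x : Fin 4 → ℤ) (s : ℝ) (η : LGConfig 4 G) :
    classicalResponse r (c + v) b q (x + v) s (configShift v η) = classicalResponse r c b q x s η := by
  unfold classicalResponse
  rw [tiltedMin_configShift, tiltedMin_configShift]

omit [BorelSpace G] in
/-- **Translation invariance of the classical carrier** (cube and plaquette move with the site). [folklore] -/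
theorem carrierCl_configShift (C s β : ℝ) (R : ℕ) (q : Fin 4 × Fin 4) (x v : Fin 4 → ℤ) (η : LGConfig 4 G) :
    carrierCl r C s β R q (x + v) (configShift v η) = carrierCl r C s β R q x η := by
  unfold carrierCl
  have hc : (fun k => (x + v) k - ((R : ℤ) + 1)) = (fun k => x k - ((R : ℤ) + 1)) + v := by
    funext k; simp only [Pi.add_apply]; ring
  rw [hc, classicalResponse_configShift]

/-- **The fixed-scale split, uniformly in the site** (`β₁` depends on `R`, `q` and the constants only): both sides of the inequality are
translation invariant (`kerE_plane_configShift`, `carrierCl_configShift`). [folklore] -/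
theorem pureSplit_fixedScale_uniform {R : ℕ} (hR : 1 ≤ R) (q : Fin 4 × Fin 4) {C_s C₁ A₀ : ℝ}
    (hCs : 0 < C_s) (hC₁ : 0 < C₁) (hA₀ : 0 < A₀) :
    ∃ β₁ : ℝ, ∀ β : ℝ, β₁ ≤ β → ∀ (x : Fin 4 → ℤ) (η : LGConfig 4 G),
      (R : ℝ) ^ 4 / C₁ * |kerE G r β (fun k => x k - (R + 1)) (2 * R + 3) η (plane G r q x) - r.N| ≤
        A₀ + carrierCl r C_s 1 β R q x η := by
  obtain ⟨β₁, h⟩ := pureSplit_fixedScale r hR q 0 hCs hC₁ hA₀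
  refine ⟨β₁, fun β hβ x η => ?_⟩
  have hη : configShift x (configShift (-x) η) = η := by
    rw [configShift_configShift, add_neg_cancel]; funext e; simp
  have h0 := h β hβ (configShift (-x) η)
  have hk := kerE_plane_configShift G r x β (fun k => (0 : Fin 4 → ℤ) k - ((R : ℤ) + 1)) (2 * R + 3) (configShift (-x) η) q 0
  have hcar := carrierCl_configShift r C_s 1 β R q 0 x (configShift (-x) η)
  have hc : ((fun k => (0 : Fin 4 → ℤ) k - ((R : ℤ) + 1)) + x) = fun k => x k - ((R : ℤ) + 1) := by
    funext k; simp only [Pi.add_apply, Pi.zero_apply]; ring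
  rw [hη, zero_add] at hk hcar
  rw [hc] at hk
  rw [← hk, ← hcar] at h0
  exact h0

end Translation

/-! ## §5 Bounded scale ranges; the inequality in the letters of `SplitCl`; the onset reformulation of (split-cl) -/

/-- **One onset for all scales `1 ≤ R ≤ R_max`, all six orientations, all sites, all exteriors** (finite maxima over §4). [folklore] -/
theorem pureSplit_boundedScales (R_max : ℕ) {C_s C₁ A₀ : ℝ} (hCs : 0 < C_s) (hC₁ : 0 < C₁) (hA₀ : 0 < A₀) :
    ∃ β₁ : ℝ, ∀ β : ℝ, β₁ ≤ β → ∀ R : ℕ, 1 ≤ R → R ≤ R_max → ∀ (q : Fin 4 × Fin 4) (x : Fin 4 → ℤ) (η : LGConfig 4 G),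
      (R : ℝ) ^ 4 / C₁ * |kerE G r β (fun k => x k - (R + 1)) (2 * R + 3) η (plane G r q x) - r.N| ≤
        A₀ + carrierCl r C_s 1 β R q x η := by
  classical
  -- onset per (R, q), `0` below `R = 1`
  have hex : ∀ (R : ℕ) (q : Fin 4 × Fin 4), ∃ β₁ : ℝ, 1 ≤ R → ∀ β : ℝ, β₁ ≤ β → ∀ (x : Fin 4 → ℤ) (η : LGConfig 4 G),
      (R : ℝ) ^ 4 / C₁ * |kerE G r β (fun k => x k - (R + 1)) (2 * R + 3) η (plane G r q x) - r.N| ≤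
        A₀ + carrierCl r C_s 1 β R q x η := by
    intro R q
    by_cases hR : 1 ≤ R
    · obtain ⟨β₁, h⟩ := pureSplit_fixedScale_uniform r hR q hCs hC₁ hA₀
      exact ⟨β₁, fun _ => h⟩
    · exact ⟨0, fun h => (hR h).elim⟩
  choose f hf using hex
  refine ⟨∑ R ∈ Finset.range (R_max + 1), ∑ q : Fin 4 × Fin 4, |f R q|, fun β hβ R hR hRm q x η => hf R q hR β ?_ x η⟩
  have h1 : f R q ≤ ∑ q' : Fin 4 × Fin 4, |f R q'| :=
    (le_abs_self _).trans (Finset.single_le_sum (f := fun q' => |f R q'|) (fun _ _ => abs_nonneg _) (Finset.mem_univ q))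
  have h2 : ∑ q' : Fin 4 × Fin 4, |f R q'| ≤ ∑ R' ∈ Finset.range (R_max + 1), ∑ q' : Fin 4 × Fin 4, |f R' q'| :=
    Finset.single_le_sum (f := fun R' => ∑ q' : Fin 4 × Fin 4, |f R' q'|)
      (fun _ _ => Finset.sum_nonneg fun _ _ => abs_nonneg _) (Finset.mem_range.2 (Nat.lt_succ_of_le hRm))
  linarith

/-- **In the letters of `ClassicalResponse.SplitCl`** (`SU(2)`, fundamental representation, ANY tempering data `𝔟, ε, kmax`): at the scales
`1 ≤ R ≤ R_max` the integrand inequality of (split-cl), `(R⁴/C₁)|kerE − p q β| ≤ A₀ + carrierCl C_s 1 + influenceAt`, holds for all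
`β ≥ β₁(R_max)` with the reference value `p q β := 2 = N` — the influence functional is `≥ 0` and not needed.  What (split-cl) adds is the
UNBOUNDED scale window `R ≤ ℓ₁/uRec β`. [folklore] -/
theorem splitCl_inequality_boundedScales (𝔟 : PolymerData.BlockSize) (ε : ℝ → ℕ → ℝ) (kmax : ℝ → ℕ → ℕ) (R_max : ℕ)
    {C_s C₁ A₀ : ℝ} (hCs : 0 < C_s) (hC₁ : 0 < C₁) (hA₀ : 0 < A₀) :
    ∃ β₁ : ℝ, ∀ β : ℝ, β₁ ≤ β → ∀ R : ℕ, 1 ≤ R → R ≤ R_max → ∀ (q : Fin 4 × Fin 4) (x : Fin 4 → ℤ)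
      (η : LGConfig 4 (Matrix.specialUnitaryGroup (Fin 2) ℂ)),
      (R : ℝ) ^ 4 / C₁ * |kerE (Matrix.specialUnitaryGroup (Fin 2) ℂ) (fundamentalLatticeRep 2) β (fun k => x k - (R + 1)) (2 * R + 3) η
        (plane (Matrix.specialUnitaryGroup (Fin 2) ℂ) (fundamentalLatticeRep 2) q x) - 2| ≤
        A₀ + carrierCl (fundamentalLatticeRep 2) C_s 1 β R q x η + PolymerData.influenceAt (N := 2) 𝔟 ε kmax β R q x η := by
  obtain ⟨β₁, h⟩ := pureSplit_boundedScales (fundamentalLatticeRep 2) R_max hCs hC₁ hA₀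
  refine ⟨β₁, fun β hβ R hR hRm q x η => ?_⟩
  have h1 := h β hβ R hR hRm q x η
  simp only [fundamentalLatticeRep_N, Nat.cast_ofNat] at h1
  exact h1.trans (le_add_of_nonneg_right (PolymerData.influenceAt_nonneg (N := 2) 𝔟 ε kmax β R q x η))

/-- **(split-cl) ⟸ the fixed-scale split with a TEMPERED ONSET** — the located reformulation.  If the flag-free split inequality holds at
each scale `R ≥ 1` for `β ≥ β₁ R` (one reference value `p`, constants independent of `R`), and the onset is dominated by the record's scale
window — `β₁ R ≤ β` whenever `β ≥ β₀`, `1 ≤ R`, `R·uRec β ≤ ℓ₁`, i.e. `β₁(R) ≲ uRec⁻¹(ℓ₁/R) ≈ 4b₀·log R` — then tempered-d1's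
`PureSplitCl C_s C₁ A₀ β₀ ℓ₁ p` (hence `SplitCl` for every tempering, p554899 `splitCl_of_pureSplitCl`) holds.  §3–§5 give the first
hypothesis with an INEFFECTIVE onset and `p ≡ N`; an effective logarithmic onset is the renormalisation-group content. [folklore] -/
theorem pureSplitCl_of_onset {C_s C₁ A₀ β₀ ℓ₁ : ℝ} {p : Fin 4 × Fin 4 → ℝ → ℝ} (β₁ : ℕ → ℝ)
    (hfix : ∀ R : ℕ, 1 ≤ R → ∀ β : ℝ, β₁ R ≤ β → ∀ (q : Fin 4 × Fin 4) (x : Fin 4 → ℤ), q.1 < q.2 →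
      ∀ η : LGConfig 4 (Matrix.specialUnitaryGroup (Fin 2) ℂ),
      (R : ℝ) ^ 4 / C₁ * |kerE (Matrix.specialUnitaryGroup (Fin 2) ℂ) (fundamentalLatticeRep 2) β (fun k => x k - (R + 1)) (2 * R + 3) η
        (plane (Matrix.specialUnitaryGroup (Fin 2) ℂ) (fundamentalLatticeRep 2) q x) - p q β| ≤
        A₀ + carrierCl (fundamentalLatticeRep 2) C_s 1 β R q x η)
    (honset : ∀ β : ℝ, β₀ ≤ β → ∀ R : ℕ, 1 ≤ R → (R : ℝ) * Transport.uRec β ≤ ℓ₁ → β₁ R ≤ β) :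
    PureSplitCl C_s C₁ A₀ β₀ ℓ₁ p :=
  fun β hβ R hR hRa q x hq η => hfix R hR β (honset β hβ R hR hRa) q x hq η

end Summit.QuantumFields.YangMills.Cruxes.UVSeamRec.ClassicalResponse

end
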